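import Summits.QuantumAdvantage.QuantumAdvantage.Theorems.OddPrimeWalkThreeBlindBits

/-!
# OddPrimeWalk — FOUR BLIND BITS: the six pointwise parity identities (engine for item 24253, planner qa-qnc0-p2 g32, ROUND-32 §2.3)

Cell qa-qnc0, route OddPrimeWalk; support for the register-rigidity crux (R₁) `SingleClassRegisterRigidityFive`
(stmt-QuantumAdvantage-24200): the MOVE PRINCIPLE as an EXACT rigidity statement.  Prover qn-prover-3 g19.

TARGET (proved in `OddPrimeWalkFourBlindBitsInnerNull.lean`, `oddPrimeWalk_fourBlindBitsInnerNull`, the planner's typed signature): `y` ignores the bits `p₁ < p₂ < p₃ < p₄`, `u`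
vanishes there, and the win bit is CONSTANT over the completions `u^S`, `S ⊆ {p₁..p₄}`, of one weight class
`|u| + |S| ≡ b (mod 3)`; then the cuts fired at `u` inside the inner segment `(p₂, p₃]` have label counts
`N_e = #{g : p₂ < g ≤ p₃, (g + W_g(u)) ≡ e}` with `N_0 ≡ N_1 ≡ N_2 (mod 2)`.

PROOF (pointwise parity identities, as in `OddPrimeWalkThreeBlindBits`; no case tables over registers).  In base coordinates
`WIN(u^S) ⇔ cardWinFill c y u S` odd (`card_win_fillS`), the live condition of a fired cut `g` being
`v_g + |S| + q_S(g) ≢ 0 (mod 3)`, `v_g = c + g + |u| + W_g(u)`, `q_S(g) = #{s ∈ S : s < g}`.  Put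
`K_t := #{g fired : p₂ < g ≤ p₃, v_g + t ≡ 0}` (`segK`).  For two completions of the same size whose sets differ by moving
one element across the inner segment, the live indicators differ exactly on `(p₂, p₃]`, where they add up to two of the
three residue indicators; this gives six identities (checked cut position by cut position, `omega`):
`ident2a: W{1,2}+W{1,3}+K₁+K₀ ≡ 0`, `ident2b: W{2,4}+W{3,4}+K₀+K₂ ≡ 0` (class of size 2),
`ident1a: W{2}+W{3}+K₂+K₁ ≡ 0`, `ident1b: W{1}+W{2}+W{4}+W{1,2,3,4}+K₁+K₀ ≡ 0` (sizes 1, 4),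
`ident0a: W{1,2,4}+W{1,3,4}+K₂+K₁ ≡ 0`, `ident0b: W∅+W{2,3,4}+W{1,2,3}+W{1,2,4}+K₀+K₁ ≡ 0` (sizes 0, 3).
In each weight class the constancy hypothesis makes the `W`-terms cancel in pairs, whence `K₀ ≡ K₁ ≡ K₂`; and
`N_e = K_{t(e)}` with `t(e) = (3 − (c + |u| + e) % 3) % 3`.
WHAT THIS IS NOT: (R₁) itself (item 24200) is NOT proved; no separation moved.
-/

namespace Summit.QuantumAdvantage.AdviceFreeQNC0.OddConfig

open Finset

variable {n : ℕ}

/-- inner-segment count with charge shift `t`: cuts fired at `u` with `p₂ < g ≤ p₃` and `c + g + |u| + W_g(u) + t ≡ 0 (mod 3)`. -/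
def segK (c : ℕ) (y : Fin (n + 1) → (Fin n → Bool) → Bool) (u : Fin n → Bool) (p₂ p₃ : Fin n) (t : ℕ) : ℕ :=
  (univ.filter fun g : Fin (n + 1) => y g u = true ∧ (p₂.val < g.val ∧ g.val ≤ p₃.val) ∧
    (c + g.val + wt u + wtPrefix u g.val + t) % 3 = 0).card

/-- pointwise parity identity `ident2a` (see the module docstring). -/
theorem ident2a (c : ℕ) (y : Fin (n + 1) → (Fin n → Bool) → Bool) (u : Fin n → Bool) (p₁ p₂ p₃ p₄ : Fin n)
    (h12 : p₁ < p₂) (h23 : p₂ < p₃) (h34 : p₃ < p₄) :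
    (cardWinFill c y u ({p₁, p₂} : Finset (Fin n)) + cardWinFill c y u ({p₁, p₃} : Finset (Fin n)) + segK c y u p₂ p₃ 1 + segK c y u p₂ p₃ 0) % 2 = 0 := by
  have l12 : p₁.val < p₂.val := h12
  have l23 : p₂.val < p₃.val := h23
  have l34 : p₃.val < p₄.val := h34
  have n12 : p₁ ≠ p₂ := fun h => by subst h; omega
  have n13 : p₁ ≠ p₃ := fun h => by subst h; omega
  unfold cardWinFill segK
  simp only [card_filter, ← sum_add_distrib]
  rw [sum_nat_mod, sum_eq_zero]
  · norm_num
  intro g _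
  by_cases hy : y g u = true
  · simp only [hy, true_and, ite_and, sum_pair n12, card_pair n12, sum_pair n13, card_pair n13]
    rcases (by omega : g.val ≤ p₁.val ∨ (p₁.val < g.val ∧ g.val ≤ p₂.val) ∨ (p₂.val < g.val ∧ g.val ≤ p₃.val)
        ∨ (p₃.val < g.val ∧ g.val ≤ p₄.val) ∨ p₄.val < g.val) with hg | hg | hg | hg | hg
    · have a1 : ¬ p₁.val < g.val := by omega
      have a2 : ¬ p₂.val < g.val := by omega
      have a3 : ¬ p₃.val < g.val := by omega
      simp only [a1, a2, a3, reduceIte]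
      split_ifs <;> omega
    · have a1 : p₁.val < g.val := by omega
      have a2 : ¬ p₂.val < g.val := by omega
      have a3 : ¬ p₃.val < g.val := by omega
      simp only [a1, a2, a3, reduceIte]
      split_ifs <;> omega
    · have a1 : p₁.val < g.val := by omega
      have a2 : p₂.val < g.val := by omega
      have a3 : ¬ p₃.val < g.val := by omega
      have a5 : g.val ≤ p₃.val := by omega
      simp only [a1, a2, a3, a5, reduceIte]
      split_ifs <;> omega
    · have a1 : p₁.val < g.val := by omega
      have a2 : p₂.val < g.val := by omega
      have a3 : p₃.val < g.val := by omega
      have a5 : ¬ g.val ≤ p₃.val := by omega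
      simp only [a1, a2, a3, a5, reduceIte]
      split_ifs <;> omega
    · have a1 : p₁.val < g.val := by omega
      have a2 : p₂.val < g.val := by omega
      have a3 : p₃.val < g.val := by omega
      have a5 : ¬ g.val ≤ p₃.val := by omega
      simp only [a1, a2, a3, a5, reduceIte]
      split_ifs <;> omega
  · simp [hy]

/-- pointwise parity identity `ident2b` (see the module docstring). -/
theorem ident2b (c : ℕ) (y : Fin (n + 1) → (Fin n → Bool) → Bool) (u : Fin n → Bool) (p₁ p₂ p₃ p₄ : Fin n)
    (h12 : p₁ < p₂) (h23 : p₂ < p₃) (h34 : p₃ < p₄) :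
    (cardWinFill c y u ({p₂, p₄} : Finset (Fin n)) + cardWinFill c y u ({p₃, p₄} : Finset (Fin n)) + segK c y u p₂ p₃ 0 + segK c y u p₂ p₃ 2) % 2 = 0 := by
  have l12 : p₁.val < p₂.val := h12
  have l23 : p₂.val < p₃.val := h23
  have l34 : p₃.val < p₄.val := h34
  have n24 : p₂ ≠ p₄ := fun h => by subst h; omega
  have n34 : p₃ ≠ p₄ := fun h => by subst h; omega
  unfold cardWinFill segK
  simp only [card_filter, ← sum_add_distrib]
  rw [sum_nat_mod, sum_eq_zero]
  · norm_num
  intro g _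
  by_cases hy : y g u = true
  · simp only [hy, true_and, ite_and, sum_pair n24, card_pair n24, sum_pair n34, card_pair n34]
    rcases (by omega : g.val ≤ p₁.val ∨ (p₁.val < g.val ∧ g.val ≤ p₂.val) ∨ (p₂.val < g.val ∧ g.val ≤ p₃.val)
        ∨ (p₃.val < g.val ∧ g.val ≤ p₄.val) ∨ p₄.val < g.val) with hg | hg | hg | hg | hg
    · have a2 : ¬ p₂.val < g.val := by omega
      have a3 : ¬ p₃.val < g.val := by omega
      have a4 : ¬ p₄.val < g.val := by omega
      simp only [a2, a3, a4, reduceIte]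
      split_ifs <;> omega
    · have a2 : ¬ p₂.val < g.val := by omega
      have a3 : ¬ p₃.val < g.val := by omega
      have a4 : ¬ p₄.val < g.val := by omega
      simp only [a2, a3, a4, reduceIte]
      split_ifs <;> omega
    · have a2 : p₂.val < g.val := by omega
      have a3 : ¬ p₃.val < g.val := by omega
      have a4 : ¬ p₄.val < g.val := by omega
      have a5 : g.val ≤ p₃.val := by omega
      simp only [a2, a3, a4, a5, reduceIte]
      split_ifs <;> omega
    · have a2 : p₂.val < g.val := by omega
      have a3 : p₃.val < g.val := by omega
      have a4 : ¬ p₄.val < g.val := by omega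
      have a5 : ¬ g.val ≤ p₃.val := by omega
      simp only [a2, a3, a4, a5, reduceIte]
      split_ifs <;> omega
    · have a2 : p₂.val < g.val := by omega
      have a3 : p₃.val < g.val := by omega
      have a4 : p₄.val < g.val := by omega
      have a5 : ¬ g.val ≤ p₃.val := by omega
      simp only [a2, a3, a4, a5, reduceIte]
      split_ifs <;> omega
  · simp [hy]

/-- pointwise parity identity `ident1a` (see the module docstring). -/
theorem ident1a (c : ℕ) (y : Fin (n + 1) → (Fin n → Bool) → Bool) (u : Fin n → Bool) (p₁ p₂ p₃ p₄ : Fin n)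
    (h12 : p₁ < p₂) (h23 : p₂ < p₃) (h34 : p₃ < p₄) :
    (cardWinFill c y u ({p₂} : Finset (Fin n)) + cardWinFill c y u ({p₃} : Finset (Fin n)) + segK c y u p₂ p₃ 2 + segK c y u p₂ p₃ 1) % 2 = 0 := by
  have l12 : p₁.val < p₂.val := h12
  have l23 : p₂.val < p₃.val := h23
  have l34 : p₃.val < p₄.val := h34
  unfold cardWinFill segK
  simp only [card_filter, ← sum_add_distrib]
  rw [sum_nat_mod, sum_eq_zero]
  · norm_num
  intro g _
  by_cases hy : y g u = true
  · simp only [hy, true_and, ite_and, sum_singleton, card_singleton]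
    rcases (by omega : g.val ≤ p₁.val ∨ (p₁.val < g.val ∧ g.val ≤ p₂.val) ∨ (p₂.val < g.val ∧ g.val ≤ p₃.val)
        ∨ (p₃.val < g.val ∧ g.val ≤ p₄.val) ∨ p₄.val < g.val) with hg | hg | hg | hg | hg
    · have a2 : ¬ p₂.val < g.val := by omega
      have a3 : ¬ p₃.val < g.val := by omega
      simp only [a2, a3, reduceIte]
      split_ifs <;> omega
    · have a2 : ¬ p₂.val < g.val := by omega
      have a3 : ¬ p₃.val < g.val := by omega
      simp only [a2, a3, reduceIte]
      split_ifs <;> omega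
    · have a2 : p₂.val < g.val := by omega
      have a3 : ¬ p₃.val < g.val := by omega
      have a5 : g.val ≤ p₃.val := by omega
      simp only [a2, a3, a5, reduceIte]
      split_ifs <;> omega
    · have a2 : p₂.val < g.val := by omega
      have a3 : p₃.val < g.val := by omega
      have a5 : ¬ g.val ≤ p₃.val := by omega
      simp only [a2, a3, a5, reduceIte]
      split_ifs <;> omega
    · have a2 : p₂.val < g.val := by omega
      have a3 : p₃.val < g.val := by omega
      have a5 : ¬ g.val ≤ p₃.val := by omega
      simp only [a2, a3, a5, reduceIte]
      split_ifs <;> omega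
  · simp [hy]

/-- pointwise parity identity `ident1b` (see the module docstring). -/
theorem ident1b (c : ℕ) (y : Fin (n + 1) → (Fin n → Bool) → Bool) (u : Fin n → Bool) (p₁ p₂ p₃ p₄ : Fin n)
    (h12 : p₁ < p₂) (h23 : p₂ < p₃) (h34 : p₃ < p₄) :
    (cardWinFill c y u ({p₁} : Finset (Fin n)) + cardWinFill c y u ({p₂} : Finset (Fin n)) + cardWinFill c y u ({p₄} : Finset (Fin n)) + cardWinFill c y u ({p₁, p₂, p₃, p₄} : Finset (Fin n)) + segK c y u p₂ p₃ 1 + segK c y u p₂ p₃ 0) % 2 = 0 := by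
  have l12 : p₁.val < p₂.val := h12
  have l23 : p₂.val < p₃.val := h23
  have l34 : p₃.val < p₄.val := h34
  have n12 : p₁ ≠ p₂ := fun h => by subst h; omega
  have n13 : p₁ ≠ p₃ := fun h => by subst h; omega
  have n14 : p₁ ≠ p₄ := fun h => by subst h; omega
  have n23 : p₂ ≠ p₃ := fun h => by subst h; omega
  have n24 : p₂ ≠ p₄ := fun h => by subst h; omega
  have n34 : p₃ ≠ p₄ := fun h => by subst h; omega
  have m2_34 : p₂ ∉ ({p₃, p₄} : Finset (Fin n)) := by simp [n23, n24]
  have m1_234 : p₁ ∉ ({p₂, p₃, p₄} : Finset (Fin n)) := by simp [n12, n13, n14]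
  unfold cardWinFill segK
  simp only [card_filter, ← sum_add_distrib]
  rw [sum_nat_mod, sum_eq_zero]
  · norm_num
  intro g _
  by_cases hy : y g u = true
  · simp only [hy, true_and, ite_and, sum_singleton, card_singleton, sum_insert m1_234, card_insert_of_notMem m1_234, sum_insert m2_34, card_insert_of_notMem m2_34, sum_pair n34, card_pair n34]
    rcases (by omega : g.val ≤ p₁.val ∨ (p₁.val < g.val ∧ g.val ≤ p₂.val) ∨ (p₂.val < g.val ∧ g.val ≤ p₃.val)
        ∨ (p₃.val < g.val ∧ g.val ≤ p₄.val) ∨ p₄.val < g.val) with hg | hg | hg | hg | hg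
    · have a1 : ¬ p₁.val < g.val := by omega
      have a2 : ¬ p₂.val < g.val := by omega
      have a3 : ¬ p₃.val < g.val := by omega
      have a4 : ¬ p₄.val < g.val := by omega
      simp only [a1, a2, a3, a4, reduceIte]
      split_ifs <;> omega
    · have a1 : p₁.val < g.val := by omega
      have a2 : ¬ p₂.val < g.val := by omega
      have a3 : ¬ p₃.val < g.val := by omega
      have a4 : ¬ p₄.val < g.val := by omega
      simp only [a1, a2, a3, a4, reduceIte]
      split_ifs <;> omega
    · have a1 : p₁.val < g.val := by omega
      have a2 : p₂.val < g.val := by omega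
      have a3 : ¬ p₃.val < g.val := by omega
      have a4 : ¬ p₄.val < g.val := by omega
      have a5 : g.val ≤ p₃.val := by omega
      simp only [a1, a2, a3, a4, a5, reduceIte]
      split_ifs <;> omega
    · have a1 : p₁.val < g.val := by omega
      have a2 : p₂.val < g.val := by omega
      have a3 : p₃.val < g.val := by omega
      have a4 : ¬ p₄.val < g.val := by omega
      have a5 : ¬ g.val ≤ p₃.val := by omega
      simp only [a1, a2, a3, a4, a5, reduceIte]
      split_ifs <;> omega
    · have a1 : p₁.val < g.val := by omega
      have a2 : p₂.val < g.val := by omega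
      have a3 : p₃.val < g.val := by omega
      have a4 : p₄.val < g.val := by omega
      have a5 : ¬ g.val ≤ p₃.val := by omega
      simp only [a1, a2, a3, a4, a5, reduceIte]
      split_ifs <;> omega
  · simp [hy]

/-- pointwise parity identity `ident0a` (see the module docstring). -/
theorem ident0a (c : ℕ) (y : Fin (n + 1) → (Fin n → Bool) → Bool) (u : Fin n → Bool) (p₁ p₂ p₃ p₄ : Fin n)
    (h12 : p₁ < p₂) (h23 : p₂ < p₃) (h34 : p₃ < p₄) :
    (cardWinFill c y u ({p₁, p₂, p₄} : Finset (Fin n)) + cardWinFill c y u ({p₁, p₃, p₄} : Finset (Fin n)) + segK c y u p₂ p₃ 2 + segK c y u p₂ p₃ 1) % 2 = 0 := by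
  have l12 : p₁.val < p₂.val := h12
  have l23 : p₂.val < p₃.val := h23
  have l34 : p₃.val < p₄.val := h34
  have n12 : p₁ ≠ p₂ := fun h => by subst h; omega
  have n13 : p₁ ≠ p₃ := fun h => by subst h; omega
  have n14 : p₁ ≠ p₄ := fun h => by subst h; omega
  have n24 : p₂ ≠ p₄ := fun h => by subst h; omega
  have n34 : p₃ ≠ p₄ := fun h => by subst h; omega
  have m1_24 : p₁ ∉ ({p₂, p₄} : Finset (Fin n)) := by simp [n12, n14]
  have m1_34 : p₁ ∉ ({p₃, p₄} : Finset (Fin n)) := by simp [n13, n14]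
  unfold cardWinFill segK
  simp only [card_filter, ← sum_add_distrib]
  rw [sum_nat_mod, sum_eq_zero]
  · norm_num
  intro g _
  by_cases hy : y g u = true
  · simp only [hy, true_and, ite_and, sum_insert m1_24, card_insert_of_notMem m1_24, sum_pair n24, card_pair n24, sum_insert m1_34, card_insert_of_notMem m1_34, sum_pair n34, card_pair n34]
    rcases (by omega : g.val ≤ p₁.val ∨ (p₁.val < g.val ∧ g.val ≤ p₂.val) ∨ (p₂.val < g.val ∧ g.val ≤ p₃.val)
        ∨ (p₃.val < g.val ∧ g.val ≤ p₄.val) ∨ p₄.val < g.val) with hg | hg | hg | hg | hg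
    · have a1 : ¬ p₁.val < g.val := by omega
      have a2 : ¬ p₂.val < g.val := by omega
      have a3 : ¬ p₃.val < g.val := by omega
      have a4 : ¬ p₄.val < g.val := by omega
      simp only [a1, a2, a3, a4, reduceIte]
      split_ifs <;> omega
    · have a1 : p₁.val < g.val := by omega
      have a2 : ¬ p₂.val < g.val := by omega
      have a3 : ¬ p₃.val < g.val := by omega
      have a4 : ¬ p₄.val < g.val := by omega
      simp only [a1, a2, a3, a4, reduceIte]
      split_ifs <;> omega
    · have a1 : p₁.val < g.val := by omega
      have a2 : p₂.val < g.val := by omega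
      have a3 : ¬ p₃.val < g.val := by omega
      have a4 : ¬ p₄.val < g.val := by omega
      have a5 : g.val ≤ p₃.val := by omega
      simp only [a1, a2, a3, a4, a5, reduceIte]
      split_ifs <;> omega
    · have a1 : p₁.val < g.val := by omega
      have a2 : p₂.val < g.val := by omega
      have a3 : p₃.val < g.val := by omega
      have a4 : ¬ p₄.val < g.val := by omega
      have a5 : ¬ g.val ≤ p₃.val := by omega
      simp only [a1, a2, a3, a4, a5, reduceIte]
      split_ifs <;> omega
    · have a1 : p₁.val < g.val := by omega
      have a2 : p₂.val < g.val := by omega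
      have a3 : p₃.val < g.val := by omega
      have a4 : p₄.val < g.val := by omega
      have a5 : ¬ g.val ≤ p₃.val := by omega
      simp only [a1, a2, a3, a4, a5, reduceIte]
      split_ifs <;> omega
  · simp [hy]

/-- pointwise parity identity `ident0b` (see the module docstring). -/
theorem ident0b (c : ℕ) (y : Fin (n + 1) → (Fin n → Bool) → Bool) (u : Fin n → Bool) (p₁ p₂ p₃ p₄ : Fin n)
    (h12 : p₁ < p₂) (h23 : p₂ < p₃) (h34 : p₃ < p₄) :
    (cardWinFill c y u (∅ : Finset (Fin n)) + cardWinFill c y u ({p₂, p₃, p₄} : Finset (Fin n)) + cardWinFill c y u ({p₁, p₂, p₃} : Finset (Fin n)) + cardWinFill c y u ({p₁, p₂, p₄} : Finset (Fin n)) + segK c y u p₂ p₃ 0 + segK c y u p₂ p₃ 1) % 2 = 0 := by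
  have l12 : p₁.val < p₂.val := h12
  have l23 : p₂.val < p₃.val := h23
  have l34 : p₃.val < p₄.val := h34
  have n12 : p₁ ≠ p₂ := fun h => by subst h; omega
  have n13 : p₁ ≠ p₃ := fun h => by subst h; omega
  have n14 : p₁ ≠ p₄ := fun h => by subst h; omega
  have n23 : p₂ ≠ p₃ := fun h => by subst h; omega
  have n24 : p₂ ≠ p₄ := fun h => by subst h; omega
  have n34 : p₃ ≠ p₄ := fun h => by subst h; omega
  have m1_23 : p₁ ∉ ({p₂, p₃} : Finset (Fin n)) := by simp [n12, n13]
  have m1_24 : p₁ ∉ ({p₂, p₄} : Finset (Fin n)) := by simp [n12, n14]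
  have m2_34 : p₂ ∉ ({p₃, p₄} : Finset (Fin n)) := by simp [n23, n24]
  unfold cardWinFill segK
  simp only [card_filter, ← sum_add_distrib]
  rw [sum_nat_mod, sum_eq_zero]
  · norm_num
  intro g _
  by_cases hy : y g u = true
  · simp only [hy, true_and, ite_and, sum_empty, card_empty, sum_insert m2_34, card_insert_of_notMem m2_34, sum_pair n34, card_pair n34, sum_insert m1_23, card_insert_of_notMem m1_23, sum_pair n23, card_pair n23, sum_insert m1_24, card_insert_of_notMem m1_24, sum_pair n24, card_pair n24]
    rcases (by omega : g.val ≤ p₁.val ∨ (p₁.val < g.val ∧ g.val ≤ p₂.val) ∨ (p₂.val < g.val ∧ g.val ≤ p₃.val)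
        ∨ (p₃.val < g.val ∧ g.val ≤ p₄.val) ∨ p₄.val < g.val) with hg | hg | hg | hg | hg
    · have a1 : ¬ p₁.val < g.val := by omega
      have a2 : ¬ p₂.val < g.val := by omega
      have a3 : ¬ p₃.val < g.val := by omega
      have a4 : ¬ p₄.val < g.val := by omega
      simp only [a1, a2, a3, a4, reduceIte]
      split_ifs <;> omega
    · have a1 : p₁.val < g.val := by omega
      have a2 : ¬ p₂.val < g.val := by omega
      have a3 : ¬ p₃.val < g.val := by omega
      have a4 : ¬ p₄.val < g.val := by omega
      simp only [a1, a2, a3, a4, reduceIte]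
      split_ifs <;> omega
    · have a1 : p₁.val < g.val := by omega
      have a2 : p₂.val < g.val := by omega
      have a3 : ¬ p₃.val < g.val := by omega
      have a4 : ¬ p₄.val < g.val := by omega
      have a5 : g.val ≤ p₃.val := by omega
      simp only [a1, a2, a3, a4, a5, reduceIte]
      split_ifs <;> omega
    · have a1 : p₁.val < g.val := by omega
      have a2 : p₂.val < g.val := by omega
      have a3 : p₃.val < g.val := by omega
      have a4 : ¬ p₄.val < g.val := by omega
      have a5 : ¬ g.val ≤ p₃.val := by omega
      simp only [a1, a2, a3, a4, a5, reduceIte]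
      split_ifs <;> omega
    · have a1 : p₁.val < g.val := by omega
      have a2 : p₂.val < g.val := by omega
      have a3 : p₃.val < g.val := by omega
      have a4 : p₄.val < g.val := by omega
      have a5 : ¬ g.val ≤ p₃.val := by omega
      simp only [a1, a2, a3, a4, a5, reduceIte]
      split_ifs <;> omega
  · simp [hy]

end Summit.QuantumAdvantage.AdviceFreeQNC0.OddConfig
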